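import Literature.MathematicalPhysics.KineticTheory.TransportDuhamel
import Literature.Analysis.Calculus.IteratedFDerivSetIntegral
import Literature.Analysis.Calculus.DerivativeInterpolation
import Literature.Analysis.Calculus.IteratedFDerivLeibnizRecursion
import Mathlib.MeasureTheory.Integral.DominatedConvergence
import HarnessLib

/-!
# Duhamel formulas along free transport: slice regularity and derivative bounds, I

Topic: MathematicalPhysics / KineticTheory. Infrastructure for the truncated problems of the
DiPerna–Lions scheme (`truncatedProblem_globalExistence`, Cercignani–Illner–Pulvirenti 1994 §5.3
Lemma 5.3.6): the *slice-wise* (fixed time, all orders in `(x, v)`, polynomially weighted)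
regularity theory of the Duhamel formula
`U(t, z) = f₀(A_t z) e^{-∫₀ᵗ Λ_σ(A_{t-σ} z) dσ} + ∫₀ᵗ e^{-∫ₛᵗ Λ_σ(A_{t-σ}z) dσ} Γ_s(A_{t-s} z) ds`,
`A_τ(x, v) = (x - τ v, v)`, for time-dependent families of smooth slices `Λ_σ, Γ_s` which are
only *continuous* in time (the form in which the Picard iterates of Lemma 5.3.6 come; companion
of `TransportDuhamel`, where `Λ, Γ` are jointly smooth). This first file treats, at fixed
`0 ≤ s ≤ t ≤ T`:

* the shear `A_τ` (`exists_shearCLM`, `norm_iteratedFDeriv_comp_shear_le`,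
  `weight_mul_norm_iteratedFDeriv_comp_shear_le`: `(1+‖z‖)ᵏ ‖Dⁿ(g ∘ A_τ)(z)‖ ≤ (1+T)^{k+n} W`);
* time-dependent families of slices: joint continuity of all derivatives from continuity in time
  and bounds (`continuousOn_iteratedFDeriv_family`, by
  `Literature.Analysis.Calculus.continuousOn_iteratedFDeriv_param`);
* the absorption integral `J(z) = ∫ₛᵗ Λ_σ(A_{t-σ} z) dσ`: smooth, with
  `‖DⁿJ(z)‖ ≤ (1+T)ⁿ ∫ₛᵗ ℓ` for any continuous majorant `‖DⁿΛ_σ‖ ≤ ℓ(σ)`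
  (`contDiff_absorptionIntegral_slice`, `norm_iteratedFDeriv_absorptionIntegral_le`);
* the Duhamel integrand `K(z) = e^{-J(z)} Γ_s(A_{t-s} z)`: smooth, and the **weighted bound with
  the two top orders separated** (`weight_mul_norm_iteratedFDeriv_duhamelIntegrand_le`):
  `(1+‖z‖)ᵏ ‖DⁿK(z)‖ ≤ (1+T)^{k+n} (Γtop + Γlow ‖DⁿJ(z)‖ + Γlow Ξ)`, affine in the top-order
  bounds `Γtop` of `Γ_s` and (through `‖DⁿJ‖`) of `Λ`, with `Ξ` depending on lower orders only
  — the mechanism of CIP's "higher moments and derivatives of `f^{n+1}` can be readily estimated in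
  terms of those of `fⁿ`" (p. 146).

Everything is proved; theorems only (the shear and the integrals are written out, no definitions).

## References

* C. Cercignani, R. Illner, M. Pulvirenti, *The Mathematical Theory of Dilute Gases*, Springer
  (1994), §5.3 Lemma 5.3.6, pp. 145–146.
-/

noncomputable section

open MeasureTheory Set Filter Function Metric intervalIntegral
open scoped ContDiff Topology

namespace Literature.MathematicalPhysics.KineticTheory

open Literature.Analysis.Calculus

variable {E : Type*} [NormedAddCommGroup E] [NormedSpace ℝ E] [FiniteDimensional ℝ E]

/-! ## The shear `A_τ (x, v) = (x - τ v, v)` -/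

section Shear

omit [FiniteDimensional ℝ E] in
/-- The free-transport shear `A_τ(x, v) = (x - τ v, v)` is a continuous linear map of norm at most
`1 + |τ|`. [folklore] -/
theorem exists_shearCLM (τ : ℝ) :
    ∃ A : (E × E) →L[ℝ] (E × E), (∀ z, A z = (z.1 - τ • z.2, z.2)) ∧ ‖A‖ ≤ 1 + |τ| := by
  refine ⟨(ContinuousLinearMap.fst ℝ E E - τ • ContinuousLinearMap.snd ℝ E E).prod
    (ContinuousLinearMap.snd ℝ E E), fun z => rfl, ?_⟩
  refine ContinuousLinearMap.opNorm_le_bound _ (by positivity) fun z => ?_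
  change ‖((z.1 - τ • z.2, z.2) : E × E)‖ ≤ (1 + |τ|) * ‖z‖
  rw [Prod.norm_def]
  have h1 : ‖z.1‖ ≤ ‖z‖ := norm_fst_le z
  have h2 : ‖z.2‖ ≤ ‖z‖ := norm_snd_le z
  have h0 : 0 ≤ ‖z‖ := norm_nonneg z
  refine max_le ?_ ?_
  · calc ‖z.1 - τ • z.2‖ ≤ ‖z.1‖ + ‖τ • z.2‖ := norm_sub_le _ _
      _ = ‖z.1‖ + |τ| * ‖z.2‖ := by rw [norm_smul, Real.norm_eq_abs]
      _ ≤ ‖z‖ + |τ| * ‖z‖ := add_le_add h1 (mul_le_mul_of_nonneg_left h2 (abs_nonneg _))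
      _ = (1 + |τ|) * ‖z‖ := by ring
  · nlinarith [abs_nonneg τ]

omit [FiniteDimensional ℝ E] in
/-- Composition with the shear costs `(1 + |τ|)ⁿ` on the `n`-th derivative:
`‖Dⁿ(g ∘ A_τ)(z)‖ ≤ (1 + |τ|)ⁿ ‖Dⁿg(A_τ z)‖`. [folklore] -/
theorem norm_iteratedFDeriv_comp_shear_le {G : Type*} [NormedAddCommGroup G] [NormedSpace ℝ G]
    {g : E × E → G} (hg : ContDiff ℝ ∞ g) (τ : ℝ) (n : ℕ) (z : E × E) :
    ‖iteratedFDeriv ℝ n (fun z : E × E => g (z.1 - τ • z.2, z.2)) z‖ ≤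
      (1 + |τ|) ^ n * ‖iteratedFDeriv ℝ n g (z.1 - τ • z.2, z.2)‖ := by
  obtain ⟨A, hA, hAn⟩ := exists_shearCLM (E := E) τ
  have hfun : (fun z : E × E => g (z.1 - τ • z.2, z.2)) = g ∘ A := funext fun z => by rw [comp_apply, hA]
  rw [hfun, A.iteratedFDeriv_comp_right hg z (mod_cast le_top), hA z]
  calc ‖(iteratedFDeriv ℝ n g (z.1 - τ • z.2, z.2)).compContinuousLinearMap fun _ => A‖
      ≤ ‖iteratedFDeriv ℝ n g (z.1 - τ • z.2, z.2)‖ * ∏ _i : Fin n, ‖A‖ :=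
        ContinuousMultilinearMap.norm_compContinuousLinearMap_le _ _
    _ ≤ ‖iteratedFDeriv ℝ n g (z.1 - τ • z.2, z.2)‖ * (1 + |τ|) ^ n := by
        rw [Finset.prod_const, Finset.card_univ, Fintype.card_fin]
        exact mul_le_mul_of_nonneg_left (pow_le_pow_left₀ (norm_nonneg _) hAn n) (norm_nonneg _)
    _ = _ := mul_comm _ _

omit [FiniteDimensional ℝ E] in
/-- **Weighted derivatives through the shear, no loss of weight**: if
`(1 + ‖y‖)ᵏ ‖Dⁿg(y)‖ ≤ W` for all `y` and `|τ| ≤ T`, then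
`(1 + ‖z‖)ᵏ ‖Dⁿ(g ∘ A_τ)(z)‖ ≤ (1 + T)^(k + n) W`. [folklore] -/
theorem weight_mul_norm_iteratedFDeriv_comp_shear_le {G : Type*} [NormedAddCommGroup G]
    [NormedSpace ℝ G] {g : E × E → G} (hg : ContDiff ℝ ∞ g) {τ T : ℝ} (hτ : |τ| ≤ T) {n k : ℕ}
    {W : ℝ} (hW : ∀ y : E × E, (1 + ‖y‖) ^ k * ‖iteratedFDeriv ℝ n g y‖ ≤ W) (z : E × E) :
    (1 + ‖z‖) ^ k * ‖iteratedFDeriv ℝ n (fun z : E × E => g (z.1 - τ • z.2, z.2)) z‖ ≤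
      (1 + T) ^ (k + n) * W := by
  have hT : 0 ≤ T := (abs_nonneg τ).trans hτ
  have hW0 : 0 ≤ W := le_trans (by positivity) (hW 0)
  have hw := weight_le_shift z.1 z.2 hτ k
  have hd := norm_iteratedFDeriv_comp_shear_le hg τ n z
  have hτn : (1 + |τ|) ^ n ≤ (1 + T) ^ n := pow_le_pow_left₀ (by positivity) (by linarith) n
  calc (1 + ‖z‖) ^ k * ‖iteratedFDeriv ℝ n (fun z : E × E => g (z.1 - τ • z.2, z.2)) z‖
      ≤ ((1 + T) ^ k * (1 + ‖((z.1 - τ • z.2, z.2) : E × E)‖) ^ k) *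
          ((1 + T) ^ n * ‖iteratedFDeriv ℝ n g (z.1 - τ • z.2, z.2)‖) := by
        refine mul_le_mul hw (hd.trans ?_) (norm_nonneg _) (by positivity)
        exact mul_le_mul_of_nonneg_right hτn (norm_nonneg _)
    _ = (1 + T) ^ (k + n) * ((1 + ‖((z.1 - τ • z.2, z.2) : E × E)‖) ^ k *
          ‖iteratedFDeriv ℝ n g (z.1 - τ • z.2, z.2)‖) := by rw [pow_add]; ring
    _ ≤ (1 + T) ^ (k + n) * W := mul_le_mul_of_nonneg_left (hW _) (by positivity)

omit [FiniteDimensional ℝ E] in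
/-- The shear composed of a smooth function is smooth. [folklore] -/
theorem contDiff_comp_shear {G : Type*} [NormedAddCommGroup G] [NormedSpace ℝ G]
    {g : E × E → G} (hg : ContDiff ℝ ∞ g) (τ : ℝ) :
    ContDiff ℝ ∞ fun z : E × E => g (z.1 - τ • z.2, z.2) :=
  hg.comp ((contDiff_fst.sub (contDiff_const.smul contDiff_snd)).prodMk contDiff_snd)

end Shear

/-! ## Time-dependent families of smooth slices -/

section Family

variable {L : ℝ → E × E → ℝ} {S : Set ℝ}

omit [FiniteDimensional ℝ E] in
/-- Smooth functions with first derivative bounded by `M` are `M`-Lipschitz. [folklore] -/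
theorem norm_sub_le_of_iteratedFDeriv_one_le {g : E × E → ℝ} (hg : ContDiff ℝ ∞ g) {M : ℝ}
    (hM : ∀ y, ‖iteratedFDeriv ℝ 1 g y‖ ≤ M) (y y' : E × E) : ‖g y - g y'‖ ≤ M * ‖y - y'‖ := by
  refine convex_univ.norm_image_sub_le_of_norm_fderiv_le (fun z _ => hg.differentiable (by simp) z)
    (fun z _ => ?_) (mem_univ y') (mem_univ y)
  rw [← norm_iteratedFDeriv_one]; exact hM z

omit [FiniteDimensional ℝ E] in
/-- **Joint continuity of a family of slices** continuous in time pointwise and with bounded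
first derivatives: `(σ, y) ↦ L σ y` is continuous on `S × (E × E)`. [folklore] -/
theorem continuousOn_uncurry_family (hL : ∀ σ, ContDiff ℝ ∞ (L σ))
    (hLc : ∀ y, ContinuousOn (fun σ => L σ y) S)
    (hLb : ∀ n : ℕ, ∃ C : ℝ, ∀ σ ∈ S, ∀ y, ‖iteratedFDeriv ℝ n (L σ) y‖ ≤ C) :
    ContinuousOn (fun p : ℝ × (E × E) => L p.1 p.2) (S ×ˢ univ) := by
  obtain ⟨C₁, hC₁⟩ := hLb 1
  exact continuousOn_uncurry_of_lipschitz (fun σ₀ hσ₀ y => hLc y σ₀ hσ₀)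
    fun σ hσ y y' => norm_sub_le_of_iteratedFDeriv_one_le (hL σ) (hC₁ σ hσ) y y'

/-- **Joint continuity of all derivatives** of such a family:
`(σ, y) ↦ Dⁿ(L σ)(y)` is continuous on `S × (E × E)`. [folklore] -/
theorem continuousOn_iteratedFDeriv_family (hL : ∀ σ, ContDiff ℝ ∞ (L σ))
    (hLc : ∀ y, ContinuousOn (fun σ => L σ y) S)
    (hLb : ∀ n : ℕ, ∃ C : ℝ, ∀ σ ∈ S, ∀ y, ‖iteratedFDeriv ℝ n (L σ) y‖ ≤ C) (n : ℕ) :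
    ContinuousOn (fun p : ℝ × (E × E) => iteratedFDeriv ℝ n (L p.1) p.2) (S ×ˢ univ) :=
  continuousOn_iteratedFDeriv_param hL hLb (fun σ₀ hσ₀ y => hLc y σ₀ hσ₀) n

/-- The family composed with the time-dependent shear `σ ↦ L σ ∘ A_{t-σ}` is again continuous in
time with bounded derivatives on `[0, T]` (for `t ∈ [0, T]`), and all its derivatives are
continuous in `σ` on `[0, T]`. [folklore] -/
theorem shearFamily_props {T : ℝ} (hL : ∀ σ, ContDiff ℝ ∞ (L σ))
    (hLc : ∀ y, ContinuousOn (fun σ => L σ y) (Icc 0 T))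
    (hLb : ∀ n : ℕ, ∃ C : ℝ, ∀ σ ∈ Icc (0:ℝ) T, ∀ y, ‖iteratedFDeriv ℝ n (L σ) y‖ ≤ C)
    {t : ℝ} (ht : t ∈ Icc (0:ℝ) T) :
    (∀ σ, ContDiff ℝ ∞ fun z : E × E => L σ (z.1 - (t - σ) • z.2, z.2)) ∧
    (∀ n : ℕ, ∃ M : ℝ, ∀ σ ∈ Icc (0:ℝ) T, ∀ z : E × E,
      ‖iteratedFDeriv ℝ n (fun z : E × E => L σ (z.1 - (t - σ) • z.2, z.2)) z‖ ≤ M) ∧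
    (∀ (n : ℕ) (z : E × E), ContinuousOn
      (fun σ => iteratedFDeriv ℝ n (fun z : E × E => L σ (z.1 - (t - σ) • z.2, z.2)) z) (Icc 0 T)) := by
  have hT : 0 ≤ T := ht.1.trans ht.2
  have hτ : ∀ σ ∈ Icc (0:ℝ) T, |t - σ| ≤ T := fun σ hσ =>
    abs_le.2 ⟨by linarith [ht.1, hσ.2], by linarith [ht.2, hσ.1]⟩
  have h1 : ∀ σ, ContDiff ℝ ∞ fun z : E × E => L σ (z.1 - (t - σ) • z.2, z.2) := fun σ =>
    contDiff_comp_shear (hL σ) _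
  have h2 : ∀ n : ℕ, ∃ M : ℝ, ∀ σ ∈ Icc (0:ℝ) T, ∀ z : E × E,
      ‖iteratedFDeriv ℝ n (fun z : E × E => L σ (z.1 - (t - σ) • z.2, z.2)) z‖ ≤ M := by
    intro n
    obtain ⟨C, hC⟩ := hLb n
    refine ⟨(1 + T) ^ n * C, fun σ hσ z => (norm_iteratedFDeriv_comp_shear_le (hL σ) _ n z).trans ?_⟩
    have hC0 : 0 ≤ C := (norm_nonneg _).trans (hC σ hσ 0)
    exact mul_le_mul (pow_le_pow_left₀ (by positivity) (by linarith [hτ σ hσ]) n) (hC σ hσ _)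
      (norm_nonneg _) (by positivity)
  refine ⟨h1, h2, fun n z => ?_⟩
  -- level-0 continuity in `σ` from the joint continuity of `L`
  have hjoint := continuousOn_uncurry_family hL hLc hLb
  have h0 : ∀ σ₀ ∈ Icc (0:ℝ) T, ∀ y : E × E, ContinuousWithinAt
      (fun σ => L σ (y.1 - (t - σ) • y.2, y.2)) (Icc 0 T) σ₀ := by
    intro σ₀ hσ₀ y
    have hγ : Continuous fun σ : ℝ => ((σ, (y.1 - (t - σ) • y.2, y.2)) : ℝ × (E × E)) :=
      continuous_id.prodMk ((continuous_const.sub ((continuous_const.sub continuous_id).smul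
        continuous_const)).prodMk continuous_const)
    exact ContinuousWithinAt.comp (f := fun σ : ℝ => ((σ, (y.1 - (t - σ) • y.2, y.2)) : ℝ × (E × E)))
      (x := σ₀) (hjoint (σ₀, _) ⟨hσ₀, mem_univ _⟩) hγ.continuousWithinAt fun σ hσ => ⟨hσ, mem_univ _⟩
  intro σ₀ hσ₀
  exact continuousWithinAt_iteratedFDeriv_param h1 h2 h0 n hσ₀ z

end Family

/-! ## The absorption integral `J(z) = ∫ₛᵗ Λ_σ(A_{t-σ} z) dσ` -/

section Absorption

variable {L : ℝ → E × E → ℝ} {T : ℝ}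

/-- **The absorption integral is a smooth function of the slice variable, with derivatives
bounded by the time integral of any continuous majorant of those of `Λ`**: for
`0 ≤ s ≤ t ≤ T`, `z ↦ ∫ₛᵗ Λ_σ(A_{t-σ} z) dσ` is `C^∞`, and
`‖Dⁿ ∫ₛᵗ Λ_σ(A_{t-σ} ·) dσ (z)‖ ≤ (1 + T)ⁿ ∫ₛᵗ ℓ(σ) dσ` whenever `‖DⁿΛ_σ(y)‖ ≤ ℓ(σ)` on `[0, T]`
with `ℓ` continuous on `[0, T]`. [folklore] -/
theorem absorptionIntegral_slice (hL : ∀ σ, ContDiff ℝ ∞ (L σ))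
    (hLc : ∀ y, ContinuousOn (fun σ => L σ y) (Icc 0 T))
    (hLb : ∀ n : ℕ, ∃ C : ℝ, ∀ σ ∈ Icc (0:ℝ) T, ∀ y, ‖iteratedFDeriv ℝ n (L σ) y‖ ≤ C)
    {s t : ℝ} (hs : 0 ≤ s) (hst : s ≤ t) (htT : t ≤ T) :
    ContDiff ℝ ∞ (fun z : E × E => ∫ σ in s..t, L σ (z.1 - (t - σ) • z.2, z.2)) ∧
    ∀ (n : ℕ) (z : E × E) (ℓ : ℝ → ℝ), ContinuousOn ℓ (Icc 0 T) →
      (∀ σ ∈ Icc (0:ℝ) T, ∀ y, ‖iteratedFDeriv ℝ n (L σ) y‖ ≤ ℓ σ) →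
      ‖iteratedFDeriv ℝ n (fun z : E × E => ∫ σ in s..t, L σ (z.1 - (t - σ) • z.2, z.2)) z‖ ≤
        (1 + T) ^ n * ∫ σ in s..t, ℓ σ := by
  have ht : t ∈ Icc (0:ℝ) T := ⟨hs.trans hst, htT⟩
  have hT : 0 ≤ T := ht.1.trans ht.2
  obtain ⟨h1, h2, h3⟩ := shearFamily_props hL hLc hLb ht
  have hsub : Ioc s t ⊆ Icc 0 T := fun σ hσ => ⟨hs.trans hσ.1.le, hσ.2.trans htT⟩
  have hτ : ∀ σ ∈ Icc (0:ℝ) T, |t - σ| ≤ T := fun σ hσ =>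
    abs_le.2 ⟨by linarith [ht.1, hσ.2], by linarith [ht.2, hσ.1]⟩
  -- the interval integral as a set integral over `Ioc s t`
  have hfun : (fun z : E × E => ∫ σ in s..t, L σ (z.1 - (t - σ) • z.2, z.2)) =
      fun z : E × E => ∫ σ in Ioc s t, L σ (z.1 - (t - σ) • z.2, z.2) :=
    funext fun z => integral_of_le hst
  have key := contDiff_setIntegral_of_dominated_iteratedFDeriv (μ := volume) (F := ℝ)
    (H := fun σ (z : E × E) => L σ (z.1 - (t - σ) • z.2, z.2)) measurableSet_Ioc
    (fun σ _ => h1 σ) (fun n z => ((h3 n z).mono hsub).aestronglyMeasurable measurableSet_Ioc)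
    (fun n => by
      obtain ⟨M, hM⟩ := h2 n
      exact ⟨fun _ => M, integrableOn_const (measure_Ioc_lt_top.ne), fun σ hσ z => hM σ (hsub hσ) z⟩)
  rw [hfun]
  refine ⟨key.1, fun n z ℓ hℓ hb => ?_⟩
  have hℓi : IntegrableOn (fun σ => (1 + T) ^ n * ℓ σ) (Ioc s t) volume :=
    ((hℓ.mono (Icc_subset_Icc hs htT)).integrableOn_Icc.mono_set Ioc_subset_Icc_self).const_mul _
  refine (key.2.2 n z (fun σ => (1 + T) ^ n * ℓ σ) hℓi fun σ hσ => ?_).trans (le_of_eq ?_)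
  · refine (norm_iteratedFDeriv_comp_shear_le (hL σ) _ n z).trans ?_
    have hℓ0 : 0 ≤ ℓ σ := (norm_nonneg _).trans (hb σ (hsub hσ) 0)
    exact mul_le_mul (pow_le_pow_left₀ (by positivity) (by linarith [hτ σ (hsub hσ)]) n)
      (hb σ (hsub hσ) _) (norm_nonneg _) (by positivity)
  · rw [MeasureTheory.integral_const_mul, ← integral_of_le hst]

omit [FiniteDimensional ℝ E] in
/-- The absorption integral of a nonnegative family is nonnegative. [folklore] -/
theorem absorptionIntegral_nonneg (hL0 : ∀ σ ∈ Icc (0:ℝ) T, ∀ y, 0 ≤ L σ y) {s t : ℝ} (hs : 0 ≤ s)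
    (hst : s ≤ t) (htT : t ≤ T) (z : E × E) : 0 ≤ ∫ σ in s..t, L σ (z.1 - (t - σ) • z.2, z.2) :=
  integral_nonneg hst fun σ hσ => hL0 σ ⟨hs.trans hσ.1, hσ.2.trans htT⟩ _

/-- The absorption integral is at most `C₀ (t - s)` when `Λ ≤ C₀` on `[0, T]`. [folklore] -/
theorem absorptionIntegral_le (hL : ∀ σ, ContDiff ℝ ∞ (L σ))
    (hLc : ∀ y, ContinuousOn (fun σ => L σ y) (Icc 0 T))
    (hLb : ∀ n : ℕ, ∃ C : ℝ, ∀ σ ∈ Icc (0:ℝ) T, ∀ y, ‖iteratedFDeriv ℝ n (L σ) y‖ ≤ C)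
    {C₀ : ℝ} (hC₀ : ∀ σ ∈ Icc (0:ℝ) T, ∀ y, L σ y ≤ C₀) {s t : ℝ} (hs : 0 ≤ s) (hst : s ≤ t)
    (htT : t ≤ T) (z : E × E) : ∫ σ in s..t, L σ (z.1 - (t - σ) • z.2, z.2) ≤ C₀ * (t - s) := by
  have ht : t ∈ Icc (0:ℝ) T := ⟨hs.trans hst, htT⟩
  obtain ⟨-, -, h3⟩ := shearFamily_props hL hLc hLb ht
  have hc : ContinuousOn (fun σ => L σ (z.1 - (t - σ) • z.2, z.2)) (Icc 0 T) := by
    have := h3 0 z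
    have e : (fun σ => L σ (z.1 - (t - σ) • z.2, z.2)) =
        fun σ => (iteratedFDeriv ℝ 0 (fun z : E × E => L σ (z.1 - (t - σ) • z.2, z.2)) z) 0 := rfl
    rw [e]
    exact (continuous_eval_const (0 : Fin 0 → E × E)).comp_continuousOn this
  calc ∫ σ in s..t, L σ (z.1 - (t - σ) • z.2, z.2) ≤ ∫ _ in s..t, C₀ :=
        integral_mono_on hst ((hc.mono (Icc_subset_Icc hs htT)).intervalIntegrable_of_Icc hst)
          intervalIntegrable_const fun σ hσ => hC₀ σ ⟨hs.trans hσ.1, hσ.2.trans htT⟩ _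
    _ = C₀ * (t - s) := by rw [intervalIntegral.integral_const, smul_eq_mul, mul_comm]

/-- Continuity in the lower limit: `s ↦ ∫ₛᵗ Λ_σ(A_{t-σ} z) dσ` is continuous on `[0, t]`. [folklore] -/
theorem continuousOn_absorptionIntegral_left (hL : ∀ σ, ContDiff ℝ ∞ (L σ))
    (hLc : ∀ y, ContinuousOn (fun σ => L σ y) (Icc 0 T))
    (hLb : ∀ n : ℕ, ∃ C : ℝ, ∀ σ ∈ Icc (0:ℝ) T, ∀ y, ‖iteratedFDeriv ℝ n (L σ) y‖ ≤ C)
    {t : ℝ} (ht : t ∈ Icc (0:ℝ) T) (z : E × E) :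
    ContinuousOn (fun s => ∫ σ in s..t, L σ (z.1 - (t - σ) • z.2, z.2)) (Icc 0 t) := by
  obtain ⟨-, -, h3⟩ := shearFamily_props hL hLc hLb ht
  have hc : ContinuousOn (fun σ => L σ (z.1 - (t - σ) • z.2, z.2)) (Icc 0 T) := by
    have := h3 0 z
    have e : (fun σ => L σ (z.1 - (t - σ) • z.2, z.2)) =
        fun σ => (iteratedFDeriv ℝ 0 (fun z : E × E => L σ (z.1 - (t - σ) • z.2, z.2)) z) 0 := rfl
    rw [e]
    exact (continuous_eval_const (0 : Fin 0 → E × E)).comp_continuousOn this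
  have hint : IntegrableOn (fun σ => L σ (z.1 - (t - σ) • z.2, z.2)) (uIcc 0 t) volume := by
    rw [uIcc_of_le ht.1]
    exact (hc.mono (Icc_subset_Icc le_rfl ht.2)).integrableOn_Icc
  have h := continuousOn_primitive_interval_left hint
  rwa [uIcc_of_le ht.1] at h

end Absorption

/-! ## The Duhamel integrand `K(z) = e^{-J(z)} Γ_s(A_{t-s} z)` -/

section Integrand

variable {J : E × E → ℝ} {g : E × E → ℝ}

omit [FiniteDimensional ℝ E] in
/-- The Duhamel integrand is smooth. [folklore] -/
theorem contDiff_duhamelIntegrand (hJ : ContDiff ℝ ∞ J) (hg : ContDiff ℝ ∞ g) (τ : ℝ) :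
    ContDiff ℝ ∞ fun z : E × E => Real.exp (-J z) * g (z.1 - τ • z.2, z.2) :=
  (contDiff_exp_neg hJ).mul (contDiff_comp_shear hg τ)

omit [FiniteDimensional ℝ E] in
/-- Weighted sup bound for the Duhamel integrand (order zero): for `J(z) ≥ 0`, `|τ| ≤ T` and
`(1 + ‖y‖)ᵏ |g(y)| ≤ W`, `(1 + ‖z‖)ᵏ |e^{-J(z)} g(A_τ z)| ≤ (1 + T)ᵏ W`. [folklore] -/
theorem weight_mul_abs_duhamelIntegrand_le {z : E × E} (hJ0 : 0 ≤ J z) {τ T : ℝ} (hτ : |τ| ≤ T)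
    {k : ℕ} {W : ℝ} (hW : ∀ y : E × E, (1 + ‖y‖) ^ k * |g y| ≤ W) :
    (1 + ‖z‖) ^ k * |Real.exp (-J z) * g (z.1 - τ • z.2, z.2)| ≤ (1 + T) ^ k * W := by
  have hT : 0 ≤ T := (abs_nonneg τ).trans hτ
  have hW0 : 0 ≤ W := le_trans (by positivity) (hW 0)
  have hexp : Real.exp (-J z) ≤ 1 := Real.exp_le_one_iff.2 (neg_nonpos.2 hJ0)
  rw [abs_mul, abs_of_pos (Real.exp_pos _)]
  have hw := weight_le_shift z.1 z.2 hτ k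
  calc (1 + ‖z‖) ^ k * (Real.exp (-J z) * |g (z.1 - τ • z.2, z.2)|)
      ≤ ((1 + T) ^ k * (1 + ‖((z.1 - τ • z.2, z.2) : E × E)‖) ^ k) * (1 * |g (z.1 - τ • z.2, z.2)|) :=
        mul_le_mul hw (mul_le_mul_of_nonneg_right hexp (abs_nonneg _)) (by positivity) (by positivity)
    _ = (1 + T) ^ k * ((1 + ‖((z.1 - τ • z.2, z.2) : E × E)‖) ^ k * |g (z.1 - τ • z.2, z.2)|) := by ring
    _ ≤ (1 + T) ^ k * W := mul_le_mul_of_nonneg_left (hW _) (by positivity)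

omit [FiniteDimensional ℝ E] in
/-- **Weighted derivative bound for the Duhamel integrand, top orders separated.** Let `n ≥ 1`,
`|τ| ≤ T`, `J(z) ≥ 0`, `‖DˡJ(z)‖ ≤ S` for `1 ≤ l < n` (`S ≥ 1`), `‖DⁿJ(z)‖ ≤ d`, and for the
slice `g`: `(1 + ‖y‖)ᵏ ‖Dⁱg(y)‖ ≤ Glow` for `i < n`, `(1 + ‖y‖)ᵏ ‖Dⁿg(y)‖ ≤ Gtop`. Then
`(1 + ‖z‖)ᵏ ‖Dⁿ[e^{-J} g ∘ A_τ](z)‖ ≤ (1 + T)^(k+n) (Gtop + Glow d + Glow Ξ)` with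
`Ξ = 2ⁿ⁻¹ S (2ⁿ⁻¹ S)ⁿ⁻¹ + 2ⁿ (2ⁿ S)ⁿ` depending on the lower orders only. [cite: CIPDiluteGases1994, §5.3 Lemma 5.3.6 (p. 146)] -/
theorem weight_mul_norm_iteratedFDeriv_duhamelIntegrand_le (hJ : ContDiff ℝ ∞ J) (hg : ContDiff ℝ ∞ g)
    {z : E × E} (hJ0 : 0 ≤ J z) {n : ℕ} (hn : 1 ≤ n) {S d : ℝ} (hS : 1 ≤ S)
    (hJl : ∀ l, 1 ≤ l → l < n → ‖iteratedFDeriv ℝ l J z‖ ≤ S) (hJd : ‖iteratedFDeriv ℝ n J z‖ ≤ d)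
    {τ T : ℝ} (hτ : |τ| ≤ T) {k : ℕ} {Glow Gtop : ℝ}
    (hGl : ∀ i < n, ∀ y : E × E, (1 + ‖y‖) ^ k * ‖iteratedFDeriv ℝ i g y‖ ≤ Glow)
    (hGt : ∀ y : E × E, (1 + ‖y‖) ^ k * ‖iteratedFDeriv ℝ n g y‖ ≤ Gtop) :
    (1 + ‖z‖) ^ k * ‖iteratedFDeriv ℝ n (fun z : E × E => Real.exp (-J z) * g (z.1 - τ • z.2, z.2)) z‖ ≤
      (1 + T) ^ (k + n) * (Gtop + Glow * d +
        Glow * (2 ^ (n - 1) * (S * (2 ^ (n - 1) * S) ^ (n - 1)) + 2 ^ n * (2 ^ n * S) ^ n)) := by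
  have hT : 0 ≤ T := (abs_nonneg τ).trans hτ
  have hS0 : 0 ≤ S := zero_le_one.trans hS
  have hGl0 : 0 ≤ Glow := le_trans (by positivity) (hGl 0 hn 0)
  have hGt0 : 0 ≤ Gtop := le_trans (by positivity) (hGt 0)
  have hd0 : 0 ≤ d := (norm_nonneg _).trans hJd
  have hw0 : 0 < (1 + ‖z‖) ^ k := by positivity
  -- the two factors and their derivative bounds at `z`
  set ex : E × E → ℝ := fun z => Real.exp (-J z) with hex
  set gs : E × E → ℝ := fun z => g (z.1 - τ • z.2, z.2) with hgs
  have hexs : ContDiff ℝ ∞ ex := contDiff_exp_neg hJ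
  have hgss : ContDiff ℝ ∞ gs := contDiff_comp_shear hg τ
  -- `x i = ‖Dⁱ e^{-J} (z)‖`
  obtain ⟨n', rfl⟩ : ∃ n', n = n' + 1 := ⟨n - 1, (Nat.sub_add_cancel hn).symm⟩
  simp only [Nat.add_sub_cancel]
  have hJl' : ∀ l, 1 ≤ l → l ≤ n' → ‖iteratedFDeriv ℝ l J z‖ ≤ S := fun l h1 h2 =>
    hJl l h1 (Nat.lt_succ_of_le h2)
  have hxcrude := norm_iteratedFDeriv_exp_neg_le hJ hJ0 hS hJl'
  have hxtop := norm_iteratedFDeriv_exp_neg_succ_le hJ hJ0 hS hJl' hJd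
  set Ξ₁ : ℝ := 2 ^ n' * (S * (2 ^ n' * S) ^ n') with hΞ₁
  set Ξ₂ : ℝ := (2 ^ (n' + 1) * S) ^ (n' + 1) with hΞ₂
  have hΞ₁0 : 0 ≤ Ξ₁ := by positivity
  have hΞ₂1 : 1 ≤ Ξ₂ := one_le_pow₀ (one_le_mul_of_one_le_of_one_le (one_le_pow₀ (by norm_num)) hS)
  -- `‖Dⁱ ex‖ ≤ Ξ₂` for `i ≤ n'`
  have hxmid : ∀ i ≤ n', ‖iteratedFDeriv ℝ i ex z‖ ≤ Ξ₂ := by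
    intro i hi
    refine (hxcrude i hi).trans ?_
    have h1 : (1 : ℝ) ≤ 2 ^ i * S := one_le_mul_of_one_le_of_one_le (one_le_pow₀ (by norm_num)) hS
    have h2 : (2 : ℝ) ^ i * S ≤ 2 ^ (n' + 1) * S :=
      mul_le_mul_of_nonneg_right (pow_le_pow_right₀ one_le_two (by omega)) hS0
    calc (2 ^ i * S) ^ i ≤ (2 ^ (n' + 1) * S) ^ i := pow_le_pow_left₀ (by positivity) h2 i
      _ ≤ (2 ^ (n' + 1) * S) ^ (n' + 1) := pow_le_pow_right₀ (h1.trans h2) (by omega)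
  -- `y j = (1+‖z‖)ᵏ ‖Dʲ gs (z)‖ ≤ (1+T)^(k+j) G_j`
  have hylow : ∀ j ≤ n', (1 + ‖z‖) ^ k * ‖iteratedFDeriv ℝ j gs z‖ ≤ (1 + T) ^ (k + (n' + 1)) * Glow := by
    intro j hj
    refine (weight_mul_norm_iteratedFDeriv_comp_shear_le hg hτ (hGl j (Nat.lt_succ_of_le hj)) z).trans ?_
    exact mul_le_mul_of_nonneg_right (pow_le_pow_right₀ (by linarith) (by omega)) hGl0
  have hytop : (1 + ‖z‖) ^ k * ‖iteratedFDeriv ℝ (n' + 1) gs z‖ ≤ (1 + T) ^ (k + (n' + 1)) * Gtop :=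
    weight_mul_norm_iteratedFDeriv_comp_shear_le hg hτ hGt z
  -- Leibniz with the weight on the second factor
  have hLeib := norm_iteratedFDeriv_mul_le hexs hgss z (n := n' + 1) (mod_cast le_top)
  have hsum : (1 + ‖z‖) ^ k * ∑ i ∈ Finset.range (n' + 1 + 1), ((n' + 1).choose i : ℝ) *
      ‖iteratedFDeriv ℝ i ex z‖ * ‖iteratedFDeriv ℝ (n' + 1 - i) gs z‖ ≤
      (1 + T) ^ (k + (n' + 1)) * (Gtop + Glow * d + Glow * (Ξ₁ + 2 ^ (n' + 1) * Ξ₂)) := by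
    rw [Finset.mul_sum]
    have e : ∀ i ∈ Finset.range (n' + 1 + 1), (1 + ‖z‖) ^ k * (((n' + 1).choose i : ℝ) *
        ‖iteratedFDeriv ℝ i ex z‖ * ‖iteratedFDeriv ℝ (n' + 1 - i) gs z‖) =
        ((n' + 1).choose i : ℝ) * ‖iteratedFDeriv ℝ i ex z‖ *
          ((1 + ‖z‖) ^ k * ‖iteratedFDeriv ℝ (n' + 1 - i) gs z‖) := fun i _ => by ring
    rw [Finset.sum_congr rfl e]
    refine (sum_choose_mul_le_ends (n := n' + 1) (x := fun i => ‖iteratedFDeriv ℝ i ex z‖)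
      (y := fun j => (1 + ‖z‖) ^ k * ‖iteratedFDeriv ℝ j gs z‖) (X := Ξ₂) (Y := (1 + T) ^ (k + (n' + 1)) * Glow)
      (fun i _ => norm_nonneg _) (fun j _ => by positivity) (zero_le_one.trans hΞ₂1) (by positivity)
      (fun i _ hi => hxmid i (by omega)) (fun j _ hj => hylow j (by omega))).trans ?_
    -- the ends: `x₀ y_{n'+1} + x_{n'+1} y₀`
    have hx0 : ‖iteratedFDeriv ℝ 0 ex z‖ ≤ 1 := by
      rw [norm_iteratedFDeriv_zero, hex, Real.norm_eq_abs, abs_of_pos (Real.exp_pos _)]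
      exact Real.exp_le_one_iff.2 (neg_nonpos.2 hJ0)
    have hy0 : (1 + ‖z‖) ^ k * ‖iteratedFDeriv ℝ 0 gs z‖ ≤ (1 + T) ^ (k + (n' + 1)) * Glow := hylow 0 (Nat.zero_le _)
    have hxn : ‖iteratedFDeriv ℝ (n' + 1) ex z‖ ≤ d + Ξ₁ := hxtop
    have hpos1 : 0 ≤ (1 + ‖z‖) ^ k * ‖iteratedFDeriv ℝ (n' + 1) gs z‖ := by positivity
    have hpos2 : 0 ≤ ‖iteratedFDeriv ℝ (n' + 1) ex z‖ := norm_nonneg _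
    have hA : ‖iteratedFDeriv ℝ 0 ex z‖ * ((1 + ‖z‖) ^ k * ‖iteratedFDeriv ℝ (n' + 1) gs z‖) ≤
        1 * ((1 + T) ^ (k + (n' + 1)) * Gtop) := mul_le_mul hx0 hytop hpos1 zero_le_one
    have hB : ‖iteratedFDeriv ℝ (n' + 1) ex z‖ * ((1 + ‖z‖) ^ k * ‖iteratedFDeriv ℝ 0 gs z‖) ≤
        (d + Ξ₁) * ((1 + T) ^ (k + (n' + 1)) * Glow) := mul_le_mul hxn hy0 (by positivity) (by positivity)
    have hC : (2 : ℝ) ^ (n' + 1) * Ξ₂ * ((1 + T) ^ (k + (n' + 1)) * Glow) =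
        (1 + T) ^ (k + (n' + 1)) * (Glow * (2 ^ (n' + 1) * Ξ₂)) := by ring
    rw [hC]
    nlinarith [hA, hB]
  calc (1 + ‖z‖) ^ k * ‖iteratedFDeriv ℝ (n' + 1) (fun z : E × E => Real.exp (-J z) * g (z.1 - τ • z.2, z.2)) z‖
      ≤ (1 + ‖z‖) ^ k * ∑ i ∈ Finset.range (n' + 1 + 1), ((n' + 1).choose i : ℝ) *
          ‖iteratedFDeriv ℝ i ex z‖ * ‖iteratedFDeriv ℝ (n' + 1 - i) gs z‖ :=
        mul_le_mul_of_nonneg_left hLeib hw0.le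
    _ ≤ _ := hsum

end Integrand

end Literature.MathematicalPhysics.KineticTheory

end
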